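import Literature.AnabelianGeometry.EtaleTheta.Discharge.Sec3Remark362
import Literature.AnabelianGeometry.EtaleTheta.Discharge.Sec3Thm37OfInputsOfProp34Const
import Literature.AnabelianGeometry.SemiGraphs.CosetCategoriesFSM
import Literature.AlgebraicGeometry.Frobenioids.MonoidRealification
import Mathlib.Algebra.Module.Rat
import Mathlib.CategoryTheory.Endomorphism
import Mathlib.GroupTheory.OrderOfElement
import HarnessLib

/-!
# [EtTh] Remark 3.6.2, conjunct 2 («`Φ^{bs-fld}` is always non-dilating») DERIVED at the printed
# constant-field category `D^cnst = 𝓑(G_K)⁰` from Prop. 3.4 (ii) relative to `D^cnst` and the constant-line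
# inputs — along EVERY endomorphism, with no «pull-back fixes the constants» binder (proof-only)

S. Mochizuki, *The étale theta function and its Frobenioid-theoretic manifestations*, Publ. RIMS **45**
(2009) [MochizukiEtTh2009], §3, Remark 3.6.2, PDF p. 78 (printed 304): "`Φ^{bs-fld}` is always non-dilating
and strictly rational" [cite: MochizukiEtTh2009, Rmk 3.6.2 p.78]; Prop. 3.4 (ii) p. 74; the setting p. 72
(printed 298) "`D^cnst := B(Spec K)⁰` … the natural surjection `Π^tp_X ↠ G_K` determines a natural functor
`D₀ → D^cnst`"; [FrdI] Def. 1.1 (i) (non-dilating endomorphisms) and §0 p. 10 (monoprime monoids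
`≅ ℤ_{≥0}, ℚ_{≥0}, ℝ_{≥0}`) [cite: MochizukiFrdI2008, §0 p.10].

abc-iut cell, layer L2, seat abc-iut-w5-d164 (gen 5); proof-only sequel (0 defs) of abc-iut-f-138's
`Discharge/Sec3Remark362.lean` (p437701; FACT-LIST row F-1311 `TemperedFrobenioid.Remark362`).  There conjunct 2
of `Remark362` — non-dilating pull-backs of `Φ^{bs-fld}` along every `f : A ⟶ A` — is derived from an explicit
binder `hcnst` («pull-backs fix `ℝ·Φ₀^cnst(Y_A)` pointwise»), which the typed Def. 3.6 (i) interface does not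
supply (`cnstR_map`: STABLE, not FIXED; kernel witness `DilatingToyGenuine.not_remark362`, p437702), and which
f-138 therefore proposed as a v-next interface field.  THIS FILE shows that at the PRINTED constant-field
category no new field is needed: conjunct 2 follows from the SAME interface-genre inputs that discharge the
Aut-invariance input `hKfix` of Thm. 3.7 (ii) (abc-iut-w5-d250, `Sec3Thm37RatStdOfCnst.lean`, p428877) —
Prop. 3.4 (ii) relative to `D^cnst` (`RealifiedDivisorMonoids.Prop34Cnst`), the constant-line properties
`hLine`/`hInt`, and finiteness in `D^cnst` — now along ENDOMORPHISMS, not only automorphisms: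

* §0 `IsMonoprime.apply_eq_self_of_apply_eq_self` — NEW monoid lemma: an endomorphism of a monoprime monoid
  (`≅ ℤ_{≥0}`, `ℚ_{≥0}` or `ℝ_{≥0}`) that fixes ONE nontrivial element is the identity (additive self-maps of
  `ℕ`, `ℚ_{≥0}`, `ℝ_{≥0}` are `x ↦ c·x`: `map_nsmul`, `map_nnrat_smul`, the tree's `addMonoidHom_nnreal_apply`);
* §0′ `CosetCat.isOfFinOrder_end` — in `𝓑(G)⁰ = CosetCat G`, `G` COMPACT, every endomorphism of `G/H` is a
  bijection of a finite set, hence invertible in the finite monoid `End(G/H)`, hence of finite order;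
* §1 `iterate_ΦRlog_map_eq_map_pow'` / `exists_cnst_map_pow_eq_id'` / `exists_iterate_ΦRlog_map_eq_self` —
  abc-iut-w5-d250's §1–§2 transposed from `Aut_D(A)` to `End_D(A)` (`Functor.mapEnd`): if the image of
  `f ∈ End_D(A)` in `End_{D^cnst}(A^cnst)` has finite order, some iterate of `Φ(f)` FIXES the effective
  divisors of constants (`Prop34Cnst.ΦR_map_eq_of_cnst_map_eq`);
* §2 `exists_bsFld_ne_one_cnstDiv` — Def. 3.6 (ii)(b) («`F(A) → (Φ^{bs-fld})^gp(A)` is nonzero», the structure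
  field `exists_FΛ_div_ne`) with `hLine`, `hInt`, group-saturation and Prop. 3.4 (ii)'s `mem_FΛ_of_divΛ_eq_of`
  produce a NONTRIVIAL `r ∈ Φ^{bs-fld}(A)` which is the effective divisor of a constant;
* §3 **`bsFld_pull_eq_self_of_cnst`** / **`isNonDilating_bsFld_pull_of_cnst`** — hence `Φ(f)` is the
  identity on the monoprime `Φ^{bs-fld}(A)` (Def. 3.6 (ii)(a)): the iterate fixing `r` makes `Φ(f)` fix `r`
  (total divisibility order, `apply_eq_self_of_dvd_total_of_iterate_apply_eq`), and §0 applies; so the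
  pull-back is non-dilating (f-138's `isNonDilating_bsFld_pull_of_forall_pull_eq`);
* §5 **`remark362_of_cosetCnst`** — `Remark362 C` for every tempered Frobenioid over `treeMonoidVocab` with
  `cnst : D₀ ⥤ CosetCat G`, residual binders {`hS` ([FrdI] Def. 4.5 (ii) stub, BY NAME), `P : Prop34Cnst T cnst`,
  `hLine`, `hInt`}; **`remark362_ofRlfZ_of_cosetCnst`** at the constructed `Λ = ℤ` data (`hInt` discharged,
  `hLine` ⟸ `hcyc`, `P` ⟸ `h34 + h₀`): residual {`hS`, `h34`, `h₀`, `hcyc`}, and `…_of_prop34Const` with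
  `hcyc := Prop34Const.hcyc`.

HONEST FRAMING: refereed pre-IUT material ([FrdI] 2008, [EtTh] 2009); every hypothesis is a named predicate on
the typed Def. 3.3 (iii)/3.6 (i) data or the free [FrdI] Def. 4.5 (ii) vocabulary stub; the abstract-interface
schema gap recorded by f-138 (arbitrary `D^cnst`, no `Prop34Cnst`) is untouched; nothing here bears on
[IUTchIII] Cor. 3.12; no side taken; a FACT row is an assumption label, "proved" = this kernel check only.
-/

noncomputable section

open CategoryTheory Opposite

universe u₀ v₀ u₁ v₁ u v w

/-! ### §0 An endomorphism of a monoprime monoid fixing a nontrivial element is the identity -/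

namespace Literature.AlgebraicGeometry.Frobenioids

section Monoprime

open scoped NNReal NNRat

variable {N : Type*} [CommMonoid N]

/-- Transport along `N ≃* Multiplicative Λ`: if every additive self-map of `Λ` is `x ↦ φ(1)·x` and `Λ` is
right-cancellative away from `0`, an endomorphism of `N` fixing a nontrivial element is the identity. [folklore] -/
private theorem apply_eq_self_of_linear {Λ : Type*} [AddCommMonoid Λ] [Mul Λ] [One Λ]
    (e : N ≃* Multiplicative Λ) (hlin : ∀ (φ : Λ →+ Λ) (a : Λ), φ a = φ 1 * a)
    (hone : ∀ a : Λ, (1 : Λ) * a = a)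
    (hcancel : ∀ {c a : Λ}, a ≠ 0 → c * a = a → c = 1)
    (τ : N →* N) {x₀ : N} (hx₀ : x₀ ≠ 1) (hfix : τ x₀ = x₀) (y : N) : τ y = y := by
  -- the additive self-map of `Λ` induced by `τ`
  let φ : Λ →+ Λ := MonoidHom.toAdditive ((e.toMonoidHom.comp τ).comp e.symm.toMonoidHom)
  have hφ : ∀ z : N, φ (Multiplicative.toAdd (e z)) = Multiplicative.toAdd (e (τ z)) := by
    intro z
    change Multiplicative.toAdd (e (τ (e.symm (Multiplicative.ofAdd (Multiplicative.toAdd (e z)))))) = _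
    rw [ofAdd_toAdd, e.symm_apply_apply]
  -- `φ` fixes the nonzero element `a₀ = e x₀`, so `φ 1 = 1`
  have ha₀ : Multiplicative.toAdd (e x₀) ≠ 0 := by
    intro h
    apply hx₀
    apply e.injective
    rw [e.map_one]
    exact Multiplicative.toAdd.injective (h.trans toAdd_one.symm)
  have h1 : φ 1 = 1 := by
    have h := hφ x₀
    rw [hfix, hlin] at h
    exact hcancel ha₀ h
  -- hence `φ = id` and `τ = id`
  have hy := hφ y
  rw [hlin, h1, hone] at hy
  exact (e.injective (Multiplicative.toAdd.injective hy)).symm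

/-- **An endomorphism of a monoprime monoid that fixes one nontrivial element is the identity.**  A monoprime
monoid is `≅ ℤ_{≥0}`, `ℚ_{≥0}` or `ℝ_{≥0}` ([FrdI] §0 p. 10); an additive self-map of any of these is `x ↦ c·x`
(`ℕ`- resp. `ℚ_{≥0}`-linearity of additive maps; for `ℝ_{≥0}` monotonicity, the tree's
`addMonoidHom_nnreal_apply`), and `c·x₀ = x₀ ≠ 0` forces `c = 1`. [cite: MochizukiFrdI2008, §0 p.10] -/
theorem IsMonoprime.apply_eq_self_of_apply_eq_self (h : IsMonoprime N) (τ : N →* N) {x₀ : N} (hx₀ : x₀ ≠ 1)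
    (hfix : τ x₀ = x₀) (y : N) : τ y = y := by
  rcases h with ⟨⟨⟨e⟩⟩⟩ | ⟨⟨⟨e⟩⟩⟩ | ⟨⟨⟨e⟩⟩⟩
  · -- `ℤ`-monoprime: additive self-maps of `ℕ` are `n ↦ φ(1)·n`
    refine apply_eq_self_of_linear e (fun φ a => ?_) one_mul (fun ha h => ?_) τ hx₀ hfix y
    · induction a with
      | zero => rw [map_zero, mul_zero]
      | succ k ih => rw [map_add, ih, mul_add_one]
    · exact mul_right_cancel₀ ha (h.trans (one_mul _).symm)
  · -- `ℚ`-monoprime: additive self-maps of `ℚ_{≥0}` are `q ↦ φ(1)·q`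
    refine apply_eq_self_of_linear e (fun φ a => ?_) one_mul (fun ha h => ?_) τ hx₀ hfix y
    · have h := map_nnrat_smul φ a (1 : ℚ≥0)
      rw [smul_eq_mul, mul_one, smul_eq_mul, mul_comm] at h
      exact h
    · exact mul_right_cancel₀ ha (h.trans (one_mul _).symm)
  · -- `ℝ`-monoprime: additive self-maps of `ℝ_{≥0}` are `x ↦ φ(1)·x` (monotonicity)
    refine apply_eq_self_of_linear e (fun φ a => addMonoidHom_nnreal_apply φ a) one_mul
      (fun ha h => ?_) τ hx₀ hfix y
    exact mul_right_cancel₀ ha (h.trans (one_mul _).symm)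

end Monoprime

end Literature.AlgebraicGeometry.Frobenioids

/-! ### §0′ `𝓑(G)⁰`, `G` compact: endomorphisms have finite order -/

namespace Literature.AnabelianGeometry.SemiGraphs.CosetCat

variable {G : Type u₁} [Group G] [TopologicalSpace G] [IsTopologicalGroup G] [CompactSpace G]

/-- In the coset category `𝓑(G)⁰` of a COMPACT group every endomorphism of `G/H` (`H` open, so `G/H` finite) is
a surjective, hence bijective, `G`-map — an automorphism — and has finite order (`End(G/H)` is finite).
[cite: MochizukiEtTh2009, §3 p.72] -/
theorem isOfFinOrder_end (X : CosetCat G) (φ : End X) : IsOfFinOrder φ := by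
  haveI : Finite X.carrier := Subgroup.quotient_finite_of_isOpen _ X.sg.isOpen
  haveI : Finite (End X) := finite_hom X X
  have hbij : Function.Bijective (Hom.toFun φ) :=
    ⟨Finite.injective_iff_surjective.mpr (toFun_surjective φ), toFun_surjective φ⟩
  haveI : IsIso φ := isIso_of_bijective φ hbij
  exact isOfFinOrder_iff_isUnit.mpr ((isUnit_iff_isIso φ).mpr inferInstance)

end Literature.AnabelianGeometry.SemiGraphs.CosetCat

namespace Literature.AnabelianGeometry.EtaleTheta

open Literature.AlgebraicGeometry.Frobenioids Literature.AnabelianGeometry.SemiGraphs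

variable {D₀ : Type u₀} [Category.{v₀} D₀] {V : FrdIMonoidStub.{w}}
  {T : RealifiedDivisorMonoids (D₀ := D₀) V} {Dcnst : Type u₁} [Category.{v₁} Dcnst] {cnst : D₀ ⥤ Dcnst}
  {D : Type u} [Category.{v} D]

namespace TemperedFrobenioid

section General

variable {VD : FrdICatStub.{u, v, w} D} (C : TemperedFrobenioid T D VD)

/-! ### §1 Iterated pull-backs along an ENDOMORPHISM; finite order in `End_{D^cnst}` -/

/-- The `k`-th iterate of the pull-back `Φ^{ℝ-log}(f) = Φ₀^ℝ(f_{D₀})` along an endomorphism `f` of `A ∈ Ob(D)`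
(given as `f : A ⟶ A` in `Dᵒᵖ`) is the pull-back along the `k`-th power of the endomorphism `f_{D₀}` of `Y_A`
in `D₀` (functoriality of `Φ₀^ℝ`; powers in the monoid `End(Y_A)`). [cite: MochizukiEtTh2009, Def 3.6 p.76] -/
theorem iterate_ΦRlog_map_eq_map_pow' (A : Dᵒᵖ) (f : A ⟶ A) (k : ℕ) (x : C.ΦRlog.obj A) :
    ((C.ΦRlog.map f).hom)^[k] x =
      (T.ΦR.map (End.of (C.base.map f.unop) ^ k).op).hom x := by
  induction k generalizing x with
  | zero =>
    rw [Function.iterate_zero_apply, pow_zero, End.one_def, op_id, T.ΦR.map_id]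
    rfl
  | succ k ih =>
    rw [Function.iterate_succ_apply', ih, pow_succ, End.mul_def, op_comp, T.ΦR.map_comp,
      CommMonCat.comp_apply]
    rfl

/-- If the image of `f ∈ End_D(A)` in `End_{D^cnst}(A^cnst)` has finite order, some power `f_{D₀}ⁿ`, `n ≥ 1`, of
the endomorphism `f_{D₀}` of `Y_A` has TRIVIAL image in `End_{D^cnst}(A^cnst)`.
[cite: MochizukiEtTh2009, Thm 3.7 (iii) p.79] -/
theorem exists_cnst_map_pow_eq_id' (A : Dᵒᵖ) (f : A ⟶ A)
    (hfin : IsOfFinOrder (cnst.mapEnd (C.base.obj (unop A)) (End.of (C.base.map f.unop)))) :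
    ∃ n : ℕ, 0 < n ∧
      cnst.map (End.of (C.base.map f.unop) ^ n).asHom = cnst.map (𝟙 (C.base.obj (unop A))) := by
  obtain ⟨n, hn, h1⟩ := hfin.exists_pow_eq_one
  refine ⟨n, hn, ?_⟩
  rw [← map_pow] at h1
  change cnst.map (End.of (C.base.map f.unop) ^ n).asHom = (1 : End (cnst.obj (C.base.obj (unop A)))) at h1
  rw [h1, cnst.map_id, End.one_def]

/-- **Some iterate of `Φ(f)`, `f ∈ End_D(A)`, fixes the divisor of every constant** — Prop. 3.4 (ii) relative
to `D^cnst` (`Prop34Cnst.ΦR_map_eq_of_cnst_map_eq`: the pull-back action on the log-divisors of constants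
factors through `D₀ → D^cnst`) applied to a power `f_{D₀}ⁿ` with trivial image in `End_{D^cnst}(A^cnst)`.
[cite: MochizukiEtTh2009, Prop 3.4 (ii) p.74] -/
theorem exists_iterate_ΦRlog_map_eq_self (hP : T.Prop34Cnst cnst) (A : Dᵒᵖ) (f : A ⟶ A)
    (hfin : IsOfFinOrder (cnst.mapEnd (C.base.obj (unop A)) (End.of (C.base.map f.unop))))
    (r : C.ΦRlog.obj A) (hr : ∃ b ∈ T.FΛ (C.baseOp A), T.divΛ _ b = Algebra.GrothendieckGroup.of r) :
    ∃ n : ℕ, 0 < n ∧ ((C.ΦRlog.map f).hom)^[n] r = r := by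
  obtain ⟨n, hn, hcn⟩ := C.exists_cnst_map_pow_eq_id' A f hfin
  refine ⟨n, hn, ?_⟩
  rw [C.iterate_ΦRlog_map_eq_map_pow' A f n r, hP.ΦR_map_eq_of_cnst_map_eq _ _ hcn r hr, op_id, T.ΦR.map_id]
  rfl

/-! ### §2 A nontrivial base-field divisor among the divisors of constants -/

/-- Every element of `M^gp` is a fraction `x/y` of elements of `M`. [folklore] -/
private theorem gp_exists_eq_div' {M : Type*} [CommMonoid M] (ξ : Algebra.GrothendieckGroup M) :
    ∃ x y : M, ξ = Algebra.GrothendieckGroup.of x / Algebra.GrothendieckGroup.of y := by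
  obtain ⟨⟨x, y⟩, h⟩ := (Localization.monoidOf (⊤ : Submonoid M)).surj ξ
  exact ⟨x, y, eq_div_iff_mul_eq'.mpr h⟩

/-- In an integral monoid, `r = x/y` in `M^gp` forces `x = r·y`. [folklore] -/
private theorem eq_mul_of_of_eq_div' {M : Type*} [CommMonoid M] (hM : IsCancelMul M) {x y r : M}
    (h : Algebra.GrothendieckGroup.of r = Algebra.GrothendieckGroup.of x / Algebra.GrothendieckGroup.of y) :
    x = r * y := by
  haveI := hM
  apply Algebra.GrothendieckGroup.of_injective
  rw [map_mul, h, div_mul_cancel]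

/-- In an integral monoid, `r⁻¹ = x/y` in `M^gp` forces `y = r·x`. [folklore] -/
private theorem eq_mul_of_of_inv_eq_div' {M : Type*} [CommMonoid M] (hM : IsCancelMul M) {x y r : M}
    (h : (Algebra.GrothendieckGroup.of r)⁻¹ = Algebra.GrothendieckGroup.of x / Algebra.GrothendieckGroup.of y) :
    y = r * x := by
  haveI := hM
  apply Algebra.GrothendieckGroup.of_injective
  rw [map_mul, ← inv_inv (Algebra.GrothendieckGroup.of r), h, inv_div, div_mul_cancel]

/-- **A NONTRIVIAL element of `Φ^{bs-fld}(A)` which is the effective divisor of a constant.**  By Def. 3.6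
(ii)(b) («`F(A) → (Φ^{bs-fld})^gp(A)` is nonzero», the structure field `exists_FΛ_div_ne`) some constant `b` has
divisor `x/y` with `x ≠ y ∈ Φ(A)`; it lies on the constant line (`divΛ_mem_cnstR`), so (`hLine`, `hInt`,
group-saturation of `Φ ⊆ Φ^{ℝ-log}`) `x/y = of(r)^{±1}` with `1 ≠ r ∈ Φ^{bs-fld}(A)` the effective divisor of
`b`, resp. of `b⁻¹ ∈ B₀^Λ(Y_A)` (`isUnit_BΛ`), which is constant by Prop. 3.4 (ii) (`mem_FΛ_of_divΛ_eq_of`).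
[cite: MochizukiEtTh2009, Def 3.6 p.77] -/
theorem exists_bsFld_ne_one_cnstDiv (hP : T.Prop34Cnst cnst) (A : Dᵒᵖ)
    (hLine : ∀ (Y : D₀ᵒᵖ) (g : Algebra.GrothendieckGroup (T.ΦR.obj Y)), g ∈ T.cnstR Y →
      ∃ r : T.ΦR.obj Y, g = Algebra.GrothendieckGroup.of r ∨ g = (Algebra.GrothendieckGroup.of r)⁻¹)
    (hInt : ∀ Y : D₀ᵒᵖ, IsCancelMul (T.ΦR.obj Y)) :
    ∃ r : C.bsFld.carrier A, r ≠ 1 ∧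
      ∃ b ∈ T.FΛ (C.baseOp A), T.divΛ _ b = Algebra.GrothendieckGroup.of (r : C.ΦRlog.obj A) := by
  obtain ⟨b, hb, x, hx, y, hy, hxy, hdiv⟩ := C.exists_FΛ_div_ne A
  have hmem : Algebra.GrothendieckGroup.of x / Algebra.GrothendieckGroup.of y ∈ T.cnstR (C.baseOp A) :=
    hdiv ▸ T.divΛ_mem_cnstR _ b hb
  obtain ⟨r, hr | hr⟩ := hLine _ _ hmem
  · -- effective case: `x = r·y`, `r = div(b)`
    have hxry := eq_mul_of_of_eq_div' (hInt (C.baseOp A)) hr.symm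
    have hrΦ : r ∈ C.Φ.carrier A := (isGroupSaturated_iff' _).1 (C.isGroupSaturated A) r x hx y hy hxry.symm
    have hrbs : r ∈ C.bsFld.carrier A :=
      ⟨hrΦ, show Algebra.GrothendieckGroup.of r ∈ T.cnstR (C.baseOp A) from hr ▸ hmem⟩
    refine ⟨⟨r, hrbs⟩, fun h1 => hxy ?_, b, hb, hdiv.trans hr⟩
    have hr1 : r = 1 := congrArg Subtype.val h1
    exact hxry.trans (by rw [hr1, one_mul])
  · -- anti-effective case: `y = r·x`, `r = div(b⁻¹)` with `b⁻¹` constant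
    have hyrx := eq_mul_of_of_inv_eq_div' (hInt (C.baseOp A)) hr.symm
    have hrΦ : r ∈ C.Φ.carrier A := (isGroupSaturated_iff' _).1 (C.isGroupSaturated A) r y hy x hx hyrx.symm
    have hrbs : r ∈ C.bsFld.carrier A := by
      refine ⟨hrΦ, show Algebra.GrothendieckGroup.of r ∈ T.cnstR (C.baseOp A) from ?_⟩
      rw [← inv_inv (Algebra.GrothendieckGroup.of r), ← hr]
      exact (T.cnstR (C.baseOp A)).inv_mem hmem
    obtain ⟨b', hb'⟩ := (T.isUnit_BΛ (C.baseOp A) b).exists_left_inv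
    have hdiv' : T.divΛ (C.baseOp A) b' = Algebra.GrothendieckGroup.of r := by
      have h1 : T.divΛ (C.baseOp A) b' * T.divΛ (C.baseOp A) b = 1 := by rw [← map_mul, hb', map_one]
      rw [eq_inv_of_mul_eq_one_left h1, hdiv, hr, inv_inv]
    refine ⟨⟨r, hrbs⟩, fun h1 => hxy ?_, b', hP.mem_FΛ_of_divΛ_eq_of _ b' r hdiv', hdiv'⟩
    have hr1 : r = 1 := congrArg Subtype.val h1
    exact (hyrx.trans (by rw [hr1, one_mul])).symm

/-! ### §3 `Φ(f)` is the identity on `Φ^{bs-fld}(A)`, hence non-dilating -/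

/-- **The pull-back along every endomorphism `f` of `A` whose image in `End_{D^cnst}(A^cnst)` has finite order
FIXES `Φ^{bs-fld}(A)` pointwise**, given Prop. 3.4 (ii) relative to `D^cnst` and the constant-line properties
`hLine`, `hInt`: some iterate of `Φ(f)` fixes the nontrivial base-field divisor `r` of §2
(`exists_iterate_ΦRlog_map_eq_self`), so `Φ(f)` fixes `r` (the monoprime `Φ^{bs-fld}(A)` of Def. 3.6 (ii)(a)
is totally ordered by divisibility; abc-iut-w5-d250's `apply_eq_self_of_dvd_total_of_iterate_apply_eq`), and
an endomorphism of a monoprime monoid fixing a nontrivial element is the identity (§0).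
[cite: MochizukiEtTh2009, Rmk 3.6.2 p.78] -/
theorem bsFld_pull_eq_self_of_cnst (hP : T.Prop34Cnst cnst) (A : Dᵒᵖ) (f : A ⟶ A)
    (hLine : ∀ (Y : D₀ᵒᵖ) (g : Algebra.GrothendieckGroup (T.ΦR.obj Y)), g ∈ T.cnstR Y →
      ∃ r : T.ΦR.obj Y, g = Algebra.GrothendieckGroup.of r ∨ g = (Algebra.GrothendieckGroup.of r)⁻¹)
    (hInt : ∀ Y : D₀ᵒᵖ, IsCancelMul (T.ΦR.obj Y))
    (hfin : IsOfFinOrder (cnst.mapEnd (C.base.obj (unop A)) (End.of (C.base.map f.unop))))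
    (x : C.bsFld.carrier A) : C.bsFld.pull f x = x := by
  obtain ⟨r, hr1, hr⟩ := C.exists_bsFld_ne_one_cnstDiv hP A hLine hInt
  -- iterates of the restricted pull-back `Φ^{bs-fld}(f)` are computed in `Φ^{ℝ-log}(A)`
  have hval : ∀ (k : ℕ) (y : C.bsFld.carrier A),
      (((C.bsFld.pull f)^[k] y : C.bsFld.carrier A) : C.ΦRlog.obj A) =
        ((C.ΦRlog.map f).hom)^[k] (y : C.ΦRlog.obj A) := by
    intro k
    induction k with
    | zero => intro y; rfl
    | succ k ih =>
      intro y
      rw [Function.iterate_succ_apply', Function.iterate_succ_apply', ← ih y]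
      rfl
  -- a finite orbit of the nontrivial base-field divisor `r`
  obtain ⟨n, hn, hfixn⟩ := C.exists_iterate_ΦRlog_map_eq_self hP A f hfin r hr
  have hper : (C.bsFld.pull f)^[n] r = r := by
    apply Subtype.ext
    rw [hval n r]
    exact hfixn
  -- `Φ(f)` fixes `r` (total divisibility order on the monoprime `Φ^{bs-fld}(A)`)
  have hmono : IsMonoprime (C.bsFld.carrier A) := C.isMonoprime_bsFld A
  have hfixr : C.bsFld.pull f r = r :=
    apply_eq_self_of_dvd_total_of_iterate_apply_eq hmono.dvd_total
      (fun h₁ h₂ => monoprime_dvd_antisymm hmono h₁ h₂) (C.bsFld.pull f) hn hper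
  -- an endomorphism of a monoprime monoid fixing `r ≠ 1` is the identity
  exact hmono.apply_eq_self_of_apply_eq_self (C.bsFld.pull f) hr1 hfixr x

/-- **Remark 3.6.2, conjunct 2, DERIVED**: under the hypotheses of `bsFld_pull_eq_self_of_cnst` the pull-back
of `Φ^{bs-fld}` along `f` is non-dilating (it is the identity; f-138's
`isNonDilating_bsFld_pull_of_forall_pull_eq`). [cite: MochizukiEtTh2009, Rmk 3.6.2 p.78] -/
theorem isNonDilating_bsFld_pull_of_cnst (hP : T.Prop34Cnst cnst) (A : Dᵒᵖ) (f : A ⟶ A)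
    (hLine : ∀ (Y : D₀ᵒᵖ) (g : Algebra.GrothendieckGroup (T.ΦR.obj Y)), g ∈ T.cnstR Y →
      ∃ r : T.ΦR.obj Y, g = Algebra.GrothendieckGroup.of r ∨ g = (Algebra.GrothendieckGroup.of r)⁻¹)
    (hInt : ∀ Y : D₀ᵒᵖ, IsCancelMul (T.ΦR.obj Y))
    (hfin : IsOfFinOrder (cnst.mapEnd (C.base.obj (unop A)) (End.of (C.base.map f.unop)))) :
    IsNonDilating (C.bsFld.pull f) :=
  C.isNonDilating_bsFld_pull_of_forall_pull_eq f (C.bsFld_pull_eq_self_of_cnst hP A f hLine hInt hfin)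

end General

end TemperedFrobenioid


/-! ### §5 `Remark362` at `D^cnst = 𝓑(G)⁰` — over the tree's monoid vocabulary, and at the constructed data -/

namespace TemperedFrobenioid

section TreeVocabCoset

variable {T : RealifiedDivisorMonoids (D₀ := D₀) treeMonoidVocab.{w}}
  {GK : Type u₁} [Group GK] [TopologicalSpace GK] [IsTopologicalGroup GK] [CompactSpace GK]
  {cnst : D₀ ⥤ CosetCat GK} {VD : FrdICatStub.{u, v, w} D} (C : TemperedFrobenioid T D VD)

/-- **[EtTh] Remark 3.6.2 for every tempered Frobenioid over the tree's monoid vocabulary with a constant-field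
functor to `𝓑(G)⁰` (`CosetCat G`, `G` compact — e.g. `G_K`)**, conjunct 2 DERIVED: residual binders
{`hS` ("`Φ^{bs-fld}` strictly rational", the free [FrdI] Def. 4.5 (ii) parameter, BY NAME), `P : Prop34Cnst T cnst`
(Prop. 3.4 (ii) relative to `D^cnst`), `hLine`, `hInt` (constant-line properties of the Def. 3.6 (i) data)} —
no «pull-back fixes the constants» binder. [cite: MochizukiEtTh2009, Rmk 3.6.2 p.78] -/
theorem remark362_of_cosetCnst (hS : VD.IsStrictlyRational C.bsFldMonoid) (hP : T.Prop34Cnst cnst)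
    (hLine : ∀ (Y : D₀ᵒᵖ) (g : Algebra.GrothendieckGroup (T.ΦR.obj Y)), g ∈ T.cnstR Y →
      ∃ r : T.ΦR.obj Y, g = Algebra.GrothendieckGroup.of r ∨ g = (Algebra.GrothendieckGroup.of r)⁻¹)
    (hInt : ∀ Y : D₀ᵒᵖ, IsCancelMul (T.ΦR.obj Y)) : C.Remark362 := by
  refine ⟨hS, fun A f => ?_⟩
  rw [treeMonoidVocab_isNonDilating]
  exact C.isNonDilating_bsFld_pull_of_cnst hP A f hLine hInt (CosetCat.isOfFinOrder_end _ _)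

end TreeVocabCoset

section OfRlfZCoset

variable (dm : DivisorMonoids.{u₀, v₀, w} D₀) (hpf : ∀ Y : D₀ᵒᵖ, IsPerfFactorial (dm.Φ₀.obj Y))
  {V₀ : FrdICatStub.{u₀, v₀, w} D₀}
  {GK : Type u₁} [Group GK] [TopologicalSpace GK] [IsTopologicalGroup GK] [CompactSpace GK]
  {cnst : D₀ ⥤ CosetCat GK} {VD : FrdICatStub.{u, v, w} D}
  (C : TemperedFrobenioid (RealifiedDivisorMonoids.ofRlfZ dm hpf) D VD)

/-- **[EtTh] Remark 3.6.2 at the CONSTRUCTED `Λ = ℤ` data `ofRlfZ dm hpf` with `D^cnst = 𝓑(G)⁰`** (`G` compact):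
`hInt` is the theorem `IsPerfFactorial.Rlf.isCancelMul`, `hLine` ⟸ `hcyc` (abc-iut-w4-d008 `ofRlfZ_line`),
`P` ⟸ `h34 + h₀` (`Prop34Cnst.ofRlfZ`, p418261); residual binders {`hS`, `h34 : dm.Prop34 _ V₀`,
`h₀ : dm.Prop34Cnst₀ cnst`, `hcyc`} — properties of the Def. 3.3 (iii) data of genuine tempered coverings
(Prop. 3.4) and the free Def. 4.5 (ii) stub. [cite: MochizukiEtTh2009, Rmk 3.6.2 p.78] -/
theorem remark362_ofRlfZ_of_cosetCnst (hS : VD.IsStrictlyRational C.bsFldMonoid)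
    (h34 : dm.Prop34 treeMonoidVocab V₀) (h₀ : dm.Prop34Cnst₀ cnst)
    (hcyc : ∀ Y : D₀ᵒᵖ, ∃ d : dm.Φ₀.obj Y, ∀ b ∈ dm.F₀ Y, ∃ n : ℤ,
      dm.div₀ Y b = Algebra.GrothendieckGroup.of d ^ n) : C.Remark362 :=
  C.remark362_of_cosetCnst hS (RealifiedDivisorMonoids.Prop34Cnst.ofRlfZ h34 h₀)
    (RealifiedDivisorMonoids.ofRlfZ_line dm hpf hcyc)
    fun Y => IsPerfFactorial.Rlf.isCancelMul (hpf Y)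

/-- **The same, knit onto `DivisorMonoids.Prop34Const`** (`hcyc := Prop34Const.hcyc hC`): residual binders
{`hS`, `h34`, `h₀`, `hC : dm.Prop34Const`}. [cite: MochizukiEtTh2009, Rmk 3.6.2 p.78] -/
theorem remark362_ofRlfZ_of_prop34Const (hS : VD.IsStrictlyRational C.bsFldMonoid)
    (h34 : dm.Prop34 treeMonoidVocab V₀) (h₀ : dm.Prop34Cnst₀ cnst) (hC : dm.Prop34Const) : C.Remark362 :=
  remark362_ofRlfZ_of_cosetCnst dm hpf C hS h34 h₀ hC.hcyc

end OfRlfZCoset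

end TemperedFrobenioid

end Literature.AnabelianGeometry.EtaleTheta

end
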